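import Mathlib
import HarnessLib
import Summits.ValiantsHypothesis.ValiantsHypothesis.Theorems.LacunarySymmetroidMatrixDescartesOsculationLawGPArcWitnessNodeOne
import Summits.ValiantsHypothesis.ValiantsHypothesis.Theorems.LacunarySymmetroidMatrixDescartesOsculationLawGPArcSheetsNodeTwo
import Summits.ValiantsHypothesis.ValiantsHypothesis.Theorems.LacunarySymmetroidMatrixDescartesOsculationLawGPWitnessGeneric

/-!
# ValiantsHypothesis / LacunarySymmetroid — crux `MatrixDescartes` (stmt-ValiantsHypothesis-18050, V1),
# line `Cruxes/MatrixDescartes/Lines/osculation_law.lean` («osculation-law»), stub `stub_recursion`, ROUTE′ density residue: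
# THE (a2) PROVIDER — ARC AVOIDANCE AT NODE TWO, COFINITELY IN THE SHIFT AND IN THE SEGMENT PARAMETER

Provider for val-port-3 g1's density theorem `GPDensity.gpNodeDensePrime_of_arc (harc0) (harc1)`: `arc1_cofinite` is the text
`HOME/lmr/staged/port3-arcspec1.txt` WITH ONE ADDED HYPOTHESIS (v2, val-port-3 g1 13:20Z after the bus note 13:17Z of val-lit-p7 g13): the level products of
the witness slot fewnomials are separable (conjunct 4 of val-lit-p6 g14's `exists_generic_diagonal_witness_sum`).  Without it the
text is false (at node two the shift `C` cancels on the arc, `arc(L_i) = −G_i` with `G_i = Σ_(l≤j) σ_(l,i) t^(d_l)`, so the witness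
must have `G_i ⟂ G_(i')` and `G_i` separable; `σ_l = (s_l, 2 s_l)`, `T_l = diag(τ_l, 2τ_l)` is a counterexample to the bare text).

* the witness-side certificate at the sheet level is val-lit-p4 g14's `OsculationGeneric.finite_bad_shift_arc_node_two`
  (`…GPArcSheetsNodeTwo`: sheets `C(C − σ_(j,i))·X₁ + ι(−(G_i + (C − σ_(j,i)) t^N))`, separable pairwise-coprime `G_i` ⇒ finitely
  many bad shifts `C`), consumed BY NAME;
* `frame1_witness_eq_diagonal`, `frame1_arc_leadingCoeff` — the Y-free node-2 model of the witness is diagonal with these sheets;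
  its arc restriction over `ℝ[ε]` has `t`-leading coefficient `det W_j ≠ 0` at `ε = 1`;
* ★ **`arc1_cofinite`** — the (a2) provider: `finite_bad_shift_arc_node_two` at the witness, `arc_osc_cofinite_of_master` along `ε`
  (master curve of the Y-free model, val-lit-p5 g12's `map_segmentModel` / `node1_model_det_eq`), and back to the frame's
  congruent pencil by `osc_set_inv_congr`.

Honest framing: helper lemmas toward the OPEN stub `stub_recursion` (the second arc clause of its density residue);
the LAW `stub_osculationLaw`, `MatrixDescartes` (18050) and `VP ≠ VNP` are NOT proved.  No definitions, no named facts.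
-/

-- `Summit.ValiantsHypothesis.ValiantsHypothesis.…` is the tree's mandated single-conjunct layout (Sub = Summit).
set_option linter.dupNamespace false

noncomputable section

namespace Summit.ValiantsHypothesis.ValiantsHypothesis.Theorems.LacunarySymmetroidMatrixDescartes

open Polynomial
open scoped Matrix

namespace OsculationGeneric

/-! ### The node-two model of the witness -/

/-- At `ε = 1` the Y-free node-2 model matrix (val-lit-p5 g12's `node1_model_det_eq` shape: letters `snoc (S_ε ∘ …) (−C•1)`,
`b`-letter `S_ε(last) + C•1`) of the diagonal witness `W_l = −diag(σ_l)` is the diagonal matrix of the sheets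
`C(C − σ_(j,i))·X₁ + ι(−(G_i + (C − σ_(j,i)) t^(d_j)))`, `G_i = Σ_(l≤j) σ_(l,i) t^(d_l)` (val-lit-p4 g14's sheet shape). [folklore] -/
theorem frame1_witness_eq_diagonal (m K j : ℕ) (d : Fin (K + 1) → ℕ) (σ : Fin (K + 1) → (Fin m ⊕ Fin 0) → ℝ)
    (T W : Fin (K + 1) → Matrix (Fin m ⊕ Fin 0) (Fin m ⊕ Fin 0) ℝ) (hW : ∀ l, W l = -Matrix.diagonal (σ l))
    (h : j + 1 ≤ K + 1) (C : ℝ) :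
    (∑ l, (MvPolynomial.X (0 : Fin 2) : MvPolynomial (Fin 2) ℝ) ^ (fun l => d (Fin.castLE h l)) l • (((1 - (1 : ℝ)) • (Fin.snoc (fun l => T (Fin.castLE h (Fin.castSucc l))) (-(C • (1 : Matrix (Fin m ⊕ Fin 0) (Fin m ⊕ Fin 0) ℝ))) : Fin (j + 1) → Matrix (Fin m ⊕ Fin 0) (Fin m ⊕ Fin 0) ℝ) l + (1 : ℝ) • (Fin.snoc (fun l => W (Fin.castLE h (Fin.castSucc l))) (-(C • (1 : Matrix (Fin m ⊕ Fin 0) (Fin m ⊕ Fin 0) ℝ))) : Fin (j + 1) → Matrix (Fin m ⊕ Fin 0) (Fin m ⊕ Fin 0) ℝ) l)).map (MvPolynomial.C : ℝ →+* MvPolynomial (Fin 2) ℝ) + (MvPolynomial.X (1 : Fin 2) : MvPolynomial (Fin 2) ℝ) • (((1 - (1 : ℝ)) • (T (Fin.castLE h (Fin.last j)) + C • (1 : Matrix (Fin m ⊕ Fin 0) (Fin m ⊕ Fin 0) ℝ)) + (1 : ℝ) • (W (Fin.castLE h (Fin.last j)) + C • (1 : Matrix (Fin m ⊕ Fin 0)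 (Fin m ⊕ Fin 0) ℝ)))).map (MvPolynomial.C : ℝ →+* MvPolynomial (Fin 2) ℝ)) =
      Matrix.diagonal fun i => (MvPolynomial.C (C - σ (Fin.castLE h (Fin.last j)) i) * MvPolynomial.X 1 + Polynomial.aeval (MvPolynomial.X 0 : MvPolynomial (Fin 2) ℝ) (-((∑ l : Fin (j + 1), Polynomial.C (σ (Fin.castLE h l) i) * X ^ d (Fin.castLE h l)) + Polynomial.C (C - σ (Fin.castLE h (Fin.last j)) i) * X ^ d (Fin.castLE h (Fin.last j))))) := by
  refine Matrix.ext fun i i' => ?_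
  simp only [Matrix.add_apply, Matrix.sum_apply, Matrix.smul_apply, Matrix.map_apply,
    sub_self, zero_smul, zero_add, one_smul, Matrix.diagonal_apply, smul_eq_mul, Fin.sum_univ_castSucc,
    Fin.snoc_castSucc, Fin.snoc_last, hW, Matrix.neg_apply, Matrix.one_apply]
  split_ifs with hii'
  · subst hii'
    simp only [mul_one, map_neg, map_add, map_sub, map_sum, map_mul, map_pow, Polynomial.aeval_C, Polynomial.aeval_X,
      MvPolynomial.algebraMap_eq, mul_neg]
    rw [show (∑ x : Fin j, -(MvPolynomial.X 0 ^ d (Fin.castLE h (Fin.castSucc x)) *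
        (MvPolynomial.C (σ (Fin.castLE h (Fin.castSucc x)) i) : MvPolynomial (Fin 2) ℝ))) =
        -(∑ x : Fin j, MvPolynomial.C (σ (Fin.castLE h (Fin.castSucc x)) i) * MvPolynomial.X 0 ^ d (Fin.castLE h (Fin.castSucc x)))
      by rw [← Finset.sum_neg_distrib]; exact Finset.sum_congr rfl fun l _ => by ring]
    ring
  · simp

/-- The `t`-leading coefficient of the arc restriction (over `ℝ[ε]`, arc `b = t^(d_j)`) of the node-two master curve is
`det((1−ε)T_j + εW_j)`, nonzero at `ε = 1` for the diagonal witness. [folklore] -/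
theorem frame1_arc_leadingCoeff (m K j : ℕ) (d : Fin (K + 1) → ℕ) (hd : StrictMono d)
    (σ : Fin (K + 1) → (Fin m ⊕ Fin 0) → ℝ) (hσ : ∀ l i, 0 < σ l i)
    (T W : Fin (K + 1) → Matrix (Fin m ⊕ Fin 0) (Fin m ⊕ Fin 0) ℝ) (hW : ∀ l, W l = -Matrix.diagonal (σ l))
    (h : j + 1 ≤ K + 1) (C : ℝ) :
    ((MvPolynomial.aeval (![Polynomial.X, Polynomial.C (Polynomial.C 1) * Polynomial.X ^ d (Fin.castLE h (Fin.last j))] : Fin 2 → ℝ[X][X])) (∑ l, (MvPolynomial.X (0 : Fin 2) : MvPolynomial (Fin 2) ℝ[X]) ^ (fun l => d (Fin.castLE h l)) l • (((Fin.snoc (fun l => T (Fin.castLE h (Fin.castSucc l))) (-(C • (1 : Matrix (Fin m ⊕ Fin 0) (Fin m ⊕ Fin 0) ℝ))) : Fin (j + 1) → Matrix (Fin m ⊕ Fin 0) (Fin m ⊕ Fin 0) ℝ) l).map (fun s : ℝ => Polynomial.C s * (1 - Polynomial.X)) + ((Fin.snoc (fun l => W (Fin.castLE h (Fin.castSucc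 l))) (-(C • (1 : Matrix (Fin m ⊕ Fin 0) (Fin m ⊕ Fin 0) ℝ))) : Fin (j + 1) → Matrix (Fin m ⊕ Fin 0) (Fin m ⊕ Fin 0) ℝ) l).map (fun w : ℝ => Polynomial.C w * Polynomial.X)).map (MvPolynomial.C : ℝ[X] →+* MvPolynomial (Fin 2) ℝ[X]) + (MvPolynomial.X (1 : Fin 2) : MvPolynomial (Fin 2) ℝ[X]) • ((T (Fin.castLE h (Fin.last j)) + C • (1 : Matrix (Fin m ⊕ Fin 0) (Fin m ⊕ Fin 0) ℝ)).map (fun s : ℝ => Polynomial.C s * (1 - Polynomial.X)) + (W (Fin.castLE h (Fin.last j)) + C • (1 : Matrix (Fin m ⊕ Fin 0) (Fin m ⊕ Fin 0) ℝ)).map (fun w : ℝ => Polynomial.C w * Polynomial.X)).map (MvPolynomial.C : ℝ[X] →+* MvPolynomial (Fin 2) ℝ[X])).det).leadingCoeff.eval 1 ≠ 0 := by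
  have heN : ∀ l : Fin j, d (Fin.castLE h (Fin.castSucc l)) < d (Fin.castLE h (Fin.last j)) := by
    intro l
    apply hd
    rw [Fin.lt_def]
    simp only [Fin.val_castLE, Fin.val_castSucc, Fin.val_last]
    exact l.isLt
  rw [arc_det_master]
  -- merge the last letter (exponent `d_j`) with the `b`-part (arc coefficient `C (C 1) = 1`)
  have hmerge : (∑ l, (Polynomial.X : ℝ[X][X]) ^ (fun l => d (Fin.castLE h l)) l • ((((Fin.snoc (fun l => T (Fin.castLE h (Fin.castSucc l))) (-(C • (1 : Matrix (Fin m ⊕ Fin 0) (Fin m ⊕ Fin 0) ℝ))) : Fin (j + 1) → Matrix (Fin m ⊕ Fin 0) (Fin m ⊕ Fin 0) ℝ) l).map (fun s : ℝ => Polynomial.C s * (1 - Polynomial.X)) + ((Fin.snoc (fun l => W (Fin.castLE h (Fin.castSucc l))) (-(C • (1 : Matrix (Fin m ⊕ Fin 0) (Fin m ⊕ Fin 0) ℝ))) : Fin (j + 1) → Matrix (Fin m ⊕ Fin 0) (Fin m ⊕ Fin 0) ℝ) l).map (fun w : ℝ => Polynomial.C w * Polynomial.X))).map Polynomial.C +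
        (Polynomial.C (Polynomial.C (1 : ℝ)) * Polynomial.X ^ d (Fin.castLE h (Fin.last j))) • (((T (Fin.castLE h (Fin.last j)) + C • (1 : Matrix (Fin m ⊕ Fin 0) (Fin m ⊕ Fin 0) ℝ)).map (fun s : ℝ => Polynomial.C s * (1 - Polynomial.X)) + (W (Fin.castLE h (Fin.last j)) + C • (1 : Matrix (Fin m ⊕ Fin 0) (Fin m ⊕ Fin 0) ℝ)).map (fun w : ℝ => Polynomial.C w * Polynomial.X))).map Polynomial.C) =
      ∑ l : Fin j, (Polynomial.X : ℝ[X][X]) ^ d (Fin.castLE h (Fin.castSucc l)) •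
          ((T (Fin.castLE h (Fin.castSucc l))).map (fun s : ℝ => Polynomial.C s * (1 - Polynomial.X)) + (W (Fin.castLE h (Fin.castSucc l))).map (fun w : ℝ => Polynomial.C w * Polynomial.X)).map Polynomial.C +
        (Polynomial.C (1 : ℝ[X]) * Polynomial.X ^ d (Fin.castLE h (Fin.last j))) •
          ((T (Fin.castLE h (Fin.last j))).map (fun s : ℝ => Polynomial.C s * (1 - Polynomial.X)) + (W (Fin.castLE h (Fin.last j))).map (fun w : ℝ => Polynomial.C w * Polynomial.X)).map Polynomial.C := by
    refine Matrix.ext fun i i' => ?_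
    simp only [Matrix.add_apply, Matrix.sum_apply, Matrix.smul_apply, Matrix.map_apply, Matrix.neg_apply, Matrix.one_apply,
      smul_eq_mul, Fin.sum_univ_castSucc, Fin.snoc_castSucc, Fin.snoc_last, Polynomial.C_1, one_mul]
    split_ifs
    · simp only [mul_one, map_neg, map_add, map_sub, map_mul, map_one]
      ring
    · simp only [mul_zero, neg_zero, map_zero, map_add, map_sub, map_mul, map_one, zero_mul, add_zero]
  rw [hmerge]
  -- the `b`-part at `ε = 1` is `W_j`, with nonzero determinant
  have hdetW : ((T (Fin.castLE h (Fin.last j))).map (fun s : ℝ => Polynomial.C s * (1 - Polynomial.X)) + (W (Fin.castLE h (Fin.last j))).map (fun w : ℝ => Polynomial.C w * Polynomial.X)).det.eval 1 ≠ 0 := by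
    rw [← Polynomial.coe_evalRingHom, RingHom.map_det, RingHom.mapMatrix_apply]
    have hev : ((T (Fin.castLE h (Fin.last j))).map (fun s : ℝ => Polynomial.C s * (1 - Polynomial.X)) + (W (Fin.castLE h (Fin.last j))).map (fun w : ℝ => Polynomial.C w * Polynomial.X)).map
        (Polynomial.evalRingHom 1) = W (Fin.castLE h (Fin.last j)) := by
      refine Matrix.ext fun i i' => ?_
      simp [Matrix.add_apply, Matrix.map_apply]
    rw [hev, hW, Matrix.det_neg, Matrix.det_diagonal]
    refine mul_ne_zero (pow_ne_zero _ (by norm_num)) (Finset.prod_ne_zero_iff.2 fun i _ => (hσ _ _).ne')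
  have hdet : ((T (Fin.castLE h (Fin.last j))).map (fun s : ℝ => Polynomial.C s * (1 - Polynomial.X)) + (W (Fin.castLE h (Fin.last j))).map (fun w : ℝ => Polynomial.C w * Polynomial.X)).det ≠ 0 :=
    fun h0 => hdetW (by rw [h0, eval_zero])
  have hc : (1 : ℝ[X]) ^ Fintype.card (Fin m ⊕ Fin 0) *
      ((T (Fin.castLE h (Fin.last j))).map (fun s : ℝ => Polynomial.C s * (1 - Polynomial.X)) + (W (Fin.castLE h (Fin.last j))).map (fun w : ℝ => Polynomial.C w * Polynomial.X)).det ≠ 0 := by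
    rw [one_pow, one_mul]; exact hdet
  have hl := (leadingCoeff_det_pencil_arc (fun l : Fin j => d (Fin.castLE h (Fin.castSucc l))) (d (Fin.castLE h (Fin.last j))) heN
    (fun l => (T (Fin.castLE h (Fin.castSucc l))).map (fun s : ℝ => Polynomial.C s * (1 - Polynomial.X)) + (W (Fin.castLE h (Fin.castSucc l))).map (fun w : ℝ => Polynomial.C w * Polynomial.X))
    ((T (Fin.castLE h (Fin.last j))).map (fun s : ℝ => Polynomial.C s * (1 - Polynomial.X)) + (W (Fin.castLE h (Fin.last j))).map (fun w : ℝ => Polynomial.C w * Polynomial.X)) 1 hc).2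
  rw [Polynomial.C_1] at hl ⊢
  rw [hl, one_pow, one_mul]
  exact hdetW

/-! ### The (a2) provider in the frame's spelling (+ the separability hypothesis) -/

/-- ★ **`arc1_cofinite`** — the (a2) provider for val-port-3 g1's `gpNodeDensePrime_of_arc` (text `port3-arcspec1.txt` with the
witness-separability hypothesis of `exists_generic_diagonal_witness_sum` inserted after the distinctness hypothesis): for the
diagonal witness and every level `j ≥ 2` there is a finite set `F` of shifts such that for `C ∉ F`, `C > 0` above all witness entries,
every symmetric `T`, all `ε` off a finite set, and every split `S_ε(last) = YᵀY − C•1`, NO point of the osculation-type set of the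
node-2 curve lies on the arc `b = t^(d_j)`. [folklore] -/
theorem arc1_cofinite :
    ∀ (m K j : ℕ), 2 ≤ j → ∀ (d : Fin (K + 1) → ℕ), StrictMono d → d 0 = 0 →
    ∀ (σ : Fin (K + 1) → (Fin m ⊕ Fin 0) → ℝ), (∀ l i, 0 < σ l i) → (∀ l i i', i ≠ i' → σ l i ≠ σ l i') →
    (∀ (j' : ℕ) (hj' : j' ≤ K + 1), 2 ≤ j' →
    (∏ i : Fin m ⊕ Fin 0, ∑ l : Fin j', C (σ (Fin.castLE hj' l) i) * (X : ℝ[X]) ^ d (Fin.castLE hj' l)).Separable) →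
    ∀ (W : Fin (K + 1) → Matrix (Fin m ⊕ Fin 0) (Fin m ⊕ Fin 0) ℝ), (∀ l, W l = -Matrix.diagonal (σ l)) →
    ∀ (h : j + 1 ≤ K + 1), ∃ F : Set ℝ, F.Finite ∧ ∀ (C : ℝ), C ∉ F → 0 < C → (∀ l i, σ l i < C) →
    ∀ (T : Fin (K + 1) → Matrix (Fin m ⊕ Fin 0) (Fin m ⊕ Fin 0) ℝ), (∀ l, (T l).IsSymm) →
    ∃ B : Set ℝ, B.Finite ∧ ∀ ε : ℝ, ε ∉ B →
    ∀ Y : Matrix (Fin m ⊕ Fin 0) (Fin m ⊕ Fin 0) ℝ, Y.det ≠ 0 →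
    ((1 - ε) • T + ε • W) (Fin.castLE h (Fin.last j)) = Yᵀ * Y - C • (1 : Matrix (Fin m ⊕ Fin 0) (Fin m ⊕ Fin 0) ℝ) →
    (∀ p ∈ {p : Fin 2 → ℝ | 0 < p 0 ∧ 0 < p 1 ∧ MvPolynomial.eval p (∑ l, (MvPolynomial.X (0 : Fin 2) : MvPolynomial (Fin 2) ℝ) ^ (fun l => d (Fin.castLE h l)) l
    • ((fun l => (Y⁻¹)ᵀ * (Fin.snoc (fun l => ((1 - ε) • T + ε • W) (Fin.castLE h (Fin.castSucc l))) (-(C • (1 : Matrix (Fin m ⊕ Fin 0) (Fin m ⊕ Fin 0)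
    ℝ))) : Fin (j + 1) → Matrix (Fin m ⊕ Fin 0) (Fin m ⊕ Fin 0) ℝ) l * Y⁻¹) l).map (MvPolynomial.C : ℝ →+* MvPolynomial (Fin 2) ℝ) + (MvPolynomial.X (1 :
    Fin 2) : MvPolynomial (Fin 2) ℝ) • (Matrix.fromBlocks 1 0 0 0 : Matrix (Fin m ⊕ Fin 0) (Fin m ⊕ Fin 0) ℝ).map (MvPolynomial.C : ℝ →+* MvPolynomial
    (Fin 2) ℝ)).det = 0 ∧ MvPolynomial.eval p (MvPolynomial.X 0 * MvPolynomial.pderiv 0 (MvPolynomial.X 0 * MvPolynomial.pderiv 0 (∑ l, (MvPolynomial.X (0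
    : Fin 2) : MvPolynomial (Fin 2) ℝ) ^ (fun l => d (Fin.castLE h l)) l • ((fun l => (Y⁻¹)ᵀ * (Fin.snoc (fun l => ((1 - ε) • T + ε • W) (Fin.castLE h
    (Fin.castSucc l))) (-(C • (1 : Matrix (Fin m ⊕ Fin 0) (Fin m ⊕ Fin 0) ℝ))) : Fin (j + 1) → Matrix (Fin m ⊕ Fin 0) (Fin m ⊕ Fin 0) ℝ) l * Y⁻¹) l).map
    (MvPolynomial.C : ℝ →+* MvPolynomial (Fin 2) ℝ) + (MvPolynomial.X (1 : Fin 2) : MvPolynomial (Fin 2) ℝ) • (Matrix.fromBlocks 1 0 0 0 : Matrix (Fin m ⊕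
    Fin 0) (Fin m ⊕ Fin 0) ℝ).map (MvPolynomial.C : ℝ →+* MvPolynomial (Fin 2) ℝ)).det) * (MvPolynomial.X 1 * MvPolynomial.pderiv 1 (∑ l, (MvPolynomial.X
    (0 : Fin 2) : MvPolynomial (Fin 2) ℝ) ^ (fun l => d (Fin.castLE h l)) l • ((fun l => (Y⁻¹)ᵀ * (Fin.snoc (fun l => ((1 - ε) • T + ε • W) (Fin.castLE h
    (Fin.castSucc l))) (-(C • (1 : Matrix (Fin m ⊕ Fin 0) (Fin m ⊕ Fin 0) ℝ))) : Fin (j + 1) → Matrix (Fin m ⊕ Fin 0) (Fin m ⊕ Fin 0) ℝ) l * Y⁻¹) l).map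
    (MvPolynomial.C : ℝ →+* MvPolynomial (Fin 2) ℝ) + (MvPolynomial.X (1 : Fin 2) : MvPolynomial (Fin 2) ℝ) • (Matrix.fromBlocks 1 0 0 0 : Matrix (Fin m ⊕
    Fin 0) (Fin m ⊕ Fin 0) ℝ).map (MvPolynomial.C : ℝ →+* MvPolynomial (Fin 2) ℝ)).det) ^ 2 - 2 * (MvPolynomial.X 0 * MvPolynomial.pderiv 0
    (MvPolynomial.X 1 * MvPolynomial.pderiv 1 (∑ l, (MvPolynomial.X (0 : Fin 2) : MvPolynomial (Fin 2) ℝ) ^ (fun l => d (Fin.castLE h l)) l • ((fun l =>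
    (Y⁻¹)ᵀ * (Fin.snoc (fun l => ((1 - ε) • T + ε • W) (Fin.castLE h (Fin.castSucc l))) (-(C • (1 : Matrix (Fin m ⊕ Fin 0) (Fin m ⊕ Fin 0) ℝ))) : Fin (j +
    1) → Matrix (Fin m ⊕ Fin 0) (Fin m ⊕ Fin 0) ℝ) l * Y⁻¹) l).map (MvPolynomial.C : ℝ →+* MvPolynomial (Fin 2) ℝ) + (MvPolynomial.X (1 : Fin 2) :
    MvPolynomial (Fin 2) ℝ) • (Matrix.fromBlocks 1 0 0 0 : Matrix (Fin m ⊕ Fin 0) (Fin m ⊕ Fin 0) ℝ).map (MvPolynomial.C : ℝ →+* MvPolynomial (Fin 2)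
    ℝ)).det)) * (MvPolynomial.X 0 * MvPolynomial.pderiv 0 (∑ l, (MvPolynomial.X (0 : Fin 2) : MvPolynomial (Fin 2) ℝ) ^ (fun l => d (Fin.castLE h l)) l •
    ((fun l => (Y⁻¹)ᵀ * (Fin.snoc (fun l => ((1 - ε) • T + ε • W) (Fin.castLE h (Fin.castSucc l))) (-(C • (1 : Matrix (Fin m ⊕ Fin 0) (Fin m ⊕ Fin 0) ℝ)))
    : Fin (j + 1) → Matrix (Fin m ⊕ Fin 0) (Fin m ⊕ Fin 0) ℝ) l * Y⁻¹) l).map (MvPolynomial.C : ℝ →+* MvPolynomial (Fin 2) ℝ) + (MvPolynomial.X (1 : Fin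
    2) : MvPolynomial (Fin 2) ℝ) • (Matrix.fromBlocks 1 0 0 0 : Matrix (Fin m ⊕ Fin 0) (Fin m ⊕ Fin 0) ℝ).map (MvPolynomial.C : ℝ →+* MvPolynomial (Fin 2)
    ℝ)).det) * (MvPolynomial.X 1 * MvPolynomial.pderiv 1 (∑ l, (MvPolynomial.X (0 : Fin 2) : MvPolynomial (Fin 2) ℝ) ^ (fun l => d (Fin.castLE h l)) l •
    ((fun l => (Y⁻¹)ᵀ * (Fin.snoc (fun l => ((1 - ε) • T + ε • W) (Fin.castLE h (Fin.castSucc l))) (-(C • (1 : Matrix (Fin m ⊕ Fin 0) (Fin m ⊕ Fin 0) ℝ)))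
    : Fin (j + 1) → Matrix (Fin m ⊕ Fin 0) (Fin m ⊕ Fin 0) ℝ) l * Y⁻¹) l).map (MvPolynomial.C : ℝ →+* MvPolynomial (Fin 2) ℝ) + (MvPolynomial.X (1 : Fin
    2) : MvPolynomial (Fin 2) ℝ) • (Matrix.fromBlocks 1 0 0 0 : Matrix (Fin m ⊕ Fin 0) (Fin m ⊕ Fin 0) ℝ).map (MvPolynomial.C : ℝ →+* MvPolynomial (Fin 2)
    ℝ)).det) + MvPolynomial.X 1 * MvPolynomial.pderiv 1 (MvPolynomial.X 1 * MvPolynomial.pderiv 1 (∑ l, (MvPolynomial.X (0 : Fin 2) : MvPolynomial (Fin 2)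
    ℝ) ^ (fun l => d (Fin.castLE h l)) l • ((fun l => (Y⁻¹)ᵀ * (Fin.snoc (fun l => ((1 - ε) • T + ε • W) (Fin.castLE h (Fin.castSucc l))) (-(C • (1 :
    Matrix (Fin m ⊕ Fin 0) (Fin m ⊕ Fin 0) ℝ))) : Fin (j + 1) → Matrix (Fin m ⊕ Fin 0) (Fin m ⊕ Fin 0) ℝ) l * Y⁻¹) l).map (MvPolynomial.C : ℝ →+*
    MvPolynomial (Fin 2) ℝ) + (MvPolynomial.X (1 : Fin 2) : MvPolynomial (Fin 2) ℝ) • (Matrix.fromBlocks 1 0 0 0 : Matrix (Fin m ⊕ Fin 0) (Fin m ⊕ Fin 0)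
    ℝ).map (MvPolynomial.C : ℝ →+* MvPolynomial (Fin 2) ℝ)).det) * (MvPolynomial.X 0 * MvPolynomial.pderiv 0 (∑ l, (MvPolynomial.X (0 : Fin 2) :
    MvPolynomial (Fin 2) ℝ) ^ (fun l => d (Fin.castLE h l)) l • ((fun l => (Y⁻¹)ᵀ * (Fin.snoc (fun l => ((1 - ε) • T + ε • W) (Fin.castLE h (Fin.castSucc
    l))) (-(C • (1 : Matrix (Fin m ⊕ Fin 0) (Fin m ⊕ Fin 0) ℝ))) : Fin (j + 1) → Matrix (Fin m ⊕ Fin 0) (Fin m ⊕ Fin 0) ℝ) l * Y⁻¹) l).map (MvPolynomial.C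
    : ℝ →+* MvPolynomial (Fin 2) ℝ) + (MvPolynomial.X (1 : Fin 2) : MvPolynomial (Fin 2) ℝ) • (Matrix.fromBlocks 1 0 0 0 : Matrix (Fin m ⊕ Fin 0) (Fin m ⊕
    Fin 0) ℝ).map (MvPolynomial.C : ℝ →+* MvPolynomial (Fin 2) ℝ)).det) ^ 2) = 0},
    p 1 ≠ 1 * p 0 ^ d (Fin.castLE h (Fin.last j))) := by
  intro m K j hj d hd hd0 σ hσ hσ' hsep W hW h
  classical
  have hjpos : 0 < j := by omega
  -- the arc exponent and the full slot fewnomials `G_i = Σ_(l ≤ j) σ_(l,i) t^(d_l)` of the witness at level `j + 1`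
  obtain ⟨z0, hz0⟩ : ∃ z0 : Fin (j + 1), (z0 : ℕ) = 0 := ⟨⟨0, by omega⟩, rfl⟩
  have he0 : d (Fin.castLE h z0) = 0 := by
    have : Fin.castLE h z0 = 0 := Fin.ext (by simp [hz0])
    rw [this]; exact hd0
  have hepos : ∀ l : Fin (j + 1), l ≠ z0 → 0 < d (Fin.castLE h l) := by
    intro l hl
    rw [← hd0]
    apply hd
    rw [Fin.lt_def]
    have : (l : ℕ) ≠ 0 := fun h0 => hl (Fin.ext (by rw [h0, hz0]))
    simp only [Fin.val_castLE, Fin.val_zero]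
    omega
  obtain ⟨G, hG⟩ : ∃ G : (Fin m ⊕ Fin 0) → ℝ[X], G = fun i => (∑ l : Fin (j + 1), Polynomial.C (σ (Fin.castLE h l) i) * X ^ d (Fin.castLE h l)) := ⟨_, rfl⟩
  have hG_eval0 : ∀ i, (G i).eval 0 = σ (Fin.castLE h z0) i := by
    intro i
    simp only [hG]
    rw [eval_finsetSum, Finset.sum_eq_single z0]
    · rw [eval_mul, eval_C, eval_pow, eval_X, he0, pow_zero, mul_one]
    · intro l _ hl
      rw [eval_mul, eval_C, eval_pow, eval_X, zero_pow (hepos l hl).ne', mul_zero]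
    · intro h0; exact absurd (Finset.mem_univ _) h0
  have hG0 : ∀ i, (G i).eval 0 ≠ 0 := fun i => by rw [hG_eval0]; exact (hσ _ _).ne'
  -- separability of the level-(j+1) product: each `G_i` separable, distinct slots coprime
  have hprod : (∏ i : Fin m ⊕ Fin 0, G i).Separable := by
    simp only [hG]
    exact hsep (j + 1) h (by omega)
  obtain ⟨hGsep, hGcop⟩ := separable_and_isCoprime_of_prod G hprod
  -- the finite set of bad shifts
  have hF := finite_bad_shift_arc_node_two G (fun i => σ (Fin.castLE h (Fin.last j)) i) (d (Fin.castLE h (Fin.last j))) hGsep hGcop hG0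
  refine ⟨_, hF, fun C hC hCpos hσC T hT => ?_⟩
  have hcopW := not_not.1 hC
  -- the model curve at `ε = 1` is the product of the witness sheets
  have hΦ1 : MvPolynomial.map (Polynomial.evalRingHom (1 : ℝ)) (∑ l, (MvPolynomial.X (0 : Fin 2) : MvPolynomial (Fin 2) ℝ[X]) ^ (fun l => d (Fin.castLE h l)) l • (((Fin.snoc (fun l => T (Fin.castLE h (Fin.castSucc l))) (-(C • (1 : Matrix (Fin m ⊕ Fin 0) (Fin m ⊕ Fin 0) ℝ))) : Fin (j + 1) → Matrix (Fin m ⊕ Fin 0) (Fin m ⊕ Fin 0) ℝ) l).map (fun s : ℝ => Polynomial.C s * (1 - Polynomial.X)) + ((Fin.snoc (fun l => W (Fin.castLE h (Fin.castSucc l))) (-(C • (1 : Matrix (Fin m ⊕ Fin 0) (Fin m ⊕ Fin 0) ℝ))) : Fin (j + 1) → Matrix (Fin m ⊕ Fin 0) (Fin m ⊕ Fin 0) ℝ) l).map (fun w : ℝ => Polynomial.C w * Polynomial.X)).map (MvPolynomial.C : ℝ[X] →+* MvPolynomial (Fin 2) ℝ[X]) + (MvPolynomial.X (1 : Fin 2)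 : MvPolynomial (Fin 2) ℝ[X]) • ((T (Fin.castLE h (Fin.last j)) + C • (1 : Matrix (Fin m ⊕ Fin 0) (Fin m ⊕ Fin 0) ℝ)).map (fun s : ℝ => Polynomial.C s * (1 - Polynomial.X)) + (W (Fin.castLE h (Fin.last j)) + C • (1 : Matrix (Fin m ⊕ Fin 0) (Fin m ⊕ Fin 0) ℝ)).map (fun w : ℝ => Polynomial.C w * Polynomial.X)).map (MvPolynomial.C : ℝ[X] →+* MvPolynomial (Fin 2) ℝ[X])).det =
      ∏ i, (MvPolynomial.C (C - σ (Fin.castLE h (Fin.last j)) i) * MvPolynomial.X 1 + Polynomial.aeval (MvPolynomial.X 0 : MvPolynomial (Fin 2) ℝ) (-((∑ l : Fin (j + 1), Polynomial.C (σ (Fin.castLE h l) i) * X ^ d (Fin.castLE h l)) + Polynomial.C (C - σ (Fin.castLE h (Fin.last j)) i) * X ^ d (Fin.castLE h (Fin.last j))))) := by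
    rw [OsculationUniform.map_segmentModel (fun l => d (Fin.castLE h l)) (Fin.snoc (fun l => T (Fin.castLE h (Fin.castSucc l))) (-(C • (1 : Matrix (Fin m ⊕ Fin 0) (Fin m ⊕ Fin 0) ℝ))) : Fin (j + 1) → Matrix (Fin m ⊕ Fin 0) (Fin m ⊕ Fin 0) ℝ) (Fin.snoc (fun l => W (Fin.castLE h (Fin.castSucc l))) (-(C • (1 : Matrix (Fin m ⊕ Fin 0) (Fin m ⊕ Fin 0) ℝ))) : Fin (j + 1) → Matrix (Fin m ⊕ Fin 0) (Fin m ⊕ Fin 0) ℝ) (T (Fin.castLE h (Fin.last j)) + C • (1 : Matrix (Fin m ⊕ Fin 0) (Fin m ⊕ Fin 0) ℝ)) (W (Fin.castLE h (Fin.last j)) + C • (1 : Matrix (Fin m ⊕ Fin 0) (Fin m ⊕ Fin 0) ℝ)) (1 : ℝ),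
      frame1_witness_eq_diagonal m K j d σ T W hW h C, Matrix.det_diagonal]
  have hlc := frame1_arc_leadingCoeff m K j d hd σ hσ T W hW h C
  have transport := arc_osc_cofinite_of_master (∑ l, (MvPolynomial.X (0 : Fin 2) : MvPolynomial (Fin 2) ℝ[X]) ^ (fun l => d (Fin.castLE h l)) l • (((Fin.snoc (fun l => T (Fin.castLE h (Fin.castSucc l))) (-(C • (1 : Matrix (Fin m ⊕ Fin 0) (Fin m ⊕ Fin 0) ℝ))) : Fin (j + 1) → Matrix (Fin m ⊕ Fin 0) (Fin m ⊕ Fin 0) ℝ) l).map (fun s : ℝ => Polynomial.C s * (1 - Polynomial.X)) + ((Fin.snoc (fun l => W (Fin.castLE h (Fin.castSucc l))) (-(C • (1 : Matrix (Fin m ⊕ Fin 0) (Fin m ⊕ Fin 0) ℝ))) : Fin (j + 1) → Matrix (Fin m ⊕ Fin 0) (Fin m ⊕ Fin 0) ℝ) l).map (fun w : ℝ => Polynomial.C w * Polynomial.X)).map (MvPolynomial.C : ℝ[X] →+* MvPolynomial (Fin 2) ℝ[X]) + (MvPolynomial.X (1 : Fin 2) : MvPolynomial (Fin 2) ℝ[X])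 • ((T (Fin.castLE h (Fin.last j)) + C • (1 : Matrix (Fin m ⊕ Fin 0) (Fin m ⊕ Fin 0) ℝ)).map (fun s : ℝ => Polynomial.C s * (1 - Polynomial.X)) + (W (Fin.castLE h (Fin.last j)) + C • (1 : Matrix (Fin m ⊕ Fin 0) (Fin m ⊕ Fin 0) ℝ)).map (fun w : ℝ => Polynomial.C w * Polynomial.X)).map (MvPolynomial.C : ℝ[X] →+* MvPolynomial (Fin 2) ℝ[X])).det 1 (d (Fin.castLE h (Fin.last j))) 1
  obtain ⟨B, hB, hgood⟩ := transport hlc (by rw [hΦ1, hG] at *; exact hcopW)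
  refine ⟨B, hB, fun ε hε Y hY hYsplit => ?_⟩
  have key := hgood ε hε
  rw [OsculationUniform.map_segmentModel (fun l => d (Fin.castLE h l)) (Fin.snoc (fun l => T (Fin.castLE h (Fin.castSucc l))) (-(C • (1 : Matrix (Fin m ⊕ Fin 0) (Fin m ⊕ Fin 0) ℝ))) : Fin (j + 1) → Matrix (Fin m ⊕ Fin 0) (Fin m ⊕ Fin 0) ℝ) (Fin.snoc (fun l => W (Fin.castLE h (Fin.castSucc l))) (-(C • (1 : Matrix (Fin m ⊕ Fin 0) (Fin m ⊕ Fin 0) ℝ))) : Fin (j + 1) → Matrix (Fin m ⊕ Fin 0) (Fin m ⊕ Fin 0) ℝ) (T (Fin.castLE h (Fin.last j)) + C • (1 : Matrix (Fin m ⊕ Fin 0) (Fin m ⊕ Fin 0) ℝ)) (W (Fin.castLE h (Fin.last j)) + C • (1 : Matrix (Fin m ⊕ Fin 0) (Fin m ⊕ Fin 0) ℝ)) ε,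
    OsculationUniform.node1_model_det_eq m K j d T W h C ε Y hYsplit, ← OsculationUniform.osc_set_inv_congr m Y hY] at key
  exact key

end OsculationGeneric

end Summit.ValiantsHypothesis.ValiantsHypothesis.Theorems.LacunarySymmetroidMatrixDescartes

end
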